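import Summits.QuantumFields.YangMills.Theorems.BalabanUVNodesN15CurvedGluingCubeDressedAdjointForm
import Summits.QuantumFields.YangMills.Theorems.BalabanUVNodesN15CurvedGluingCubeSmoothCut
import Summits.QuantumFields.YangMills.Theorems.BalabanUVNodesN15CurvedGluingSpeciesCommutator
import HarnessLib

/-!
# THE ADJOINT FORM's RESOLVENT LETTER `𝒲 = (M_χ̃N_□)∘V̂∘jet∘M_χ` FOR THE SMOOTH-CUT CUBE WITH THE STRUCTURAL PERTURBATION `V̂ = unstackM C A + N_V∘pr₀`: by parts onto the flat cube's
# SANDWICHED right entries `N_□∘∇^±_μ∘M_χ = T^±_μ∘M_χ` — `𝒲 ≤ 1_S1_S·θ_𝒲e^{−ρd}`, `θ_𝒲 = βr_C + |J|·2(β^Qr_A + βr_∇) + βR_Nc_r`; NO mixed row (dag-n15-c g18, FILE 150; N15 = NE2, s1)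

Cell `pub-ymgap`, seat `pub-ymgap-dag-n15-c` (R134 (a); HUMAN RULING D-0062), generation 18.  `bears_on: R4∕N15 · K3⁸ SpineGivenEndpointR13SepCoPHV (stmt-QuantumFields-27366)`.
Filed `--kind proof --supports stmt-QuantumFields-27366 --as helper` — COUNT-NEUTRAL.  Theorems only; 0 `def`, 0 `sorry`.  Imports BY NAME FILE 148 `…CubeDressedAdjointForm` (the letter's
ROLE: `hW` of `hasMaj_projO_dressedV_comp_adj(_loc₂)`, `hasMaj_neumannR_comp_loc₂`, `hasMaj_idef_projO_dressedV_comp_adj`), dag-n15-w3 file 31 `…CurvedGluingCubeSmoothCut`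
(`hasMaj_smoothCut`), dag-n15-w3 `…CurvedGluingSpeciesCommutator` (`mmulOp_comp_mulOp_fst`); through them n15-c g8 FILE 1 `…BackgroundTupleCalculus` (`comp_fgrad_of_intertwine`,
`comp_fgradAdj_of_intertwine`, `bgrad_eq_neg_fgradAdj`, `linearMap_sum_comp`, `linearMap_comp_sum`), n15-c `…BackgroundMatrixByParts(TwoSided)` (`fgradMat`, `mmulOp_comp_pull`,
`smul_mmulOp_sub_eq`, `mmulOp_comp_pull_symm`, `smul_mmulOp_translate_sub_eq`), n15-b `…CovariantLaplacianSpecies` (`speciesOpM`, `unstackM_comp_stack_eq_speciesOpM_comp`), n15-b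
`mmulOp`∕`hasMaj_mmulOp`, lit `B11SectG.hasMaj_comp_exp`.  Nothing in the tree is modified.

WHY.  FILE 148 reads the dressed cube's right entries and its right-locality defect through ONE letter: the rows of `𝒲 = G₀∘V̂∘jet∘M_χ` (`G₀ = M_χ̃N_□` the smooth-cut flat cube, `M_χG₀ = G₀`).
With the structural perturbation `V̂ = unstackM C A + N_V∘pr₀` ((3.52)'s species with matrix coefficients + a decaying base part), `V̂∘jet = V + N_V`, `V = M_C + Σ_μ(M_{A⁺_μ}∇⁺_μ +
M_{A⁻_μ}∇⁻_μ)` (`speciesOpM`), and the lattice product rule moves each quotient LEFT of its coefficient: `M_{A⁺}∇⁺ = ∇⁺M_{A⁺∘e⁻¹} − M_{(∇⁺A⁺)∘e⁻¹}`, `M_{A⁻}∇⁻ = ∇⁻M_{A⁻∘e} − M_{∇⁺A⁻}`.  The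
quotient then meets the flat cube on its SOURCE side, behind the inserted cut: `N_□∘∇^±_μ∘M_χ`, which dag-n15-a's Neumann-by-images cube delivers SANDWICHED (`N-IIn` (a)±:
`G_□∘∇^±_μ∘M_g = T^±_μ∘M_g` for `g` supported with its translates in `□`; `M_χM_χ = M_χ`).  Hence `𝒲` is a sum of products of DISPLAYED letters — the cut row of `N_□` (`β`), the sandwiched
right entries `T^±_μ` (`β^Q`), the coefficients' row sums (`r_C`, `r_A`) and one-step differences (`r_∇`), the base part (`R_N`) — and NO mixed second-order row `∇N∇` (FILE 148's located
obstruction) appears.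

WHAT.  §1 `mmulOp_comp_fgrad_eq`, `mmulOp_comp_bgrad_eq` (the matrix product rules), `comp_species_fgrad_sandwich`, `comp_species_bgrad_sandwich` (`N∘M_{A}∇^±∘M_χ = T^±∘M_χ∘M_{A′} −
N∘M_{A″}∘M_χ` from the sandwiched identity and `M_χM_χ = M_χ`), `adjW_eq` (the letter as a finite sum of those products).  §2 ★★★ `hasMaj_adjW_smoothCut_loc₂` — THE LETTER:
`𝒲 ≤ 1_S(y)1_S(y′)·(βr_C + |J|·(2(β^Qr_A + βr_∇)) + βR_Nc_r)·e^{−ρd}` (`ρ ≤ δ`, `ρ + σ ≤ δ`, `ρ ≤ δ_N`), two-sided localized by the cuts (`supp χ` over `S`, `M_χM_χ̃ = M_χ̃`); ★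
`hasMaj_adjW_smoothCut` (indicators dropped — FILE 148's `hW`).  The two-grid defect `𝔇(𝒲′, 𝒲)` (FILE 148's `hDW`) is the verbatim `idef` twin over the same letters' defects — next file.

HONEST FRAMING ∕ LIMITS.  Lattice Leibniz + block-majorant bookkeeping over DISPLAYED letters (cut rows of the flat cube, its sandwiched right entries — hypotheses in exactly dag-n15-a
N-IIn's shape —, coefficient letters, the base part's letter); proves NO estimate of any concrete propagator; nothing of [B5]∕[B6]∕[B9] asserted ((2.37)–(2.38) p.229, (2.133)–(2.135)
p.247, (3.52) p.400, (3.62)–(3.65) pp.402–403 = SHAPES ∕ MECHANISM).  NE2⁺ NOT PRINTED, NOT proved; N15 NOT discharged; K3⁸ OPEN, skeleton v7 untouched (0∕2); counts of record UNMOVED (typed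
28∕28 · discharged 6∕27 · A 6∕28); one finite 𝕋⁴ at fixed ε — NOT infinite volume, NOT OS on ℝ⁴, NOT a mass gap, NOT Clay; R4 closes the conditional finite-𝕋⁴ rung `BalabanLadder.UV` only.
Restate-immune (no Theses import).
-/

set_option autoImplicit false

noncomputable section

open scoped BigOperators

namespace Summit.QuantumFields.YangMills.BalabanUVNodes.N15.Gluing

open Literature.MathematicalPhysics.QuantumFieldTheory.Balaban1983to89
open Literature.MathematicalPhysics.QuantumFieldTheory.Balaban1983to89.B11SectG (BlockNorm HasMaj RowSum hasMaj_comp_exp)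
open Literature.MathematicalPhysics.QuantumFieldTheory.Balaban1983to89.B6RandomWalk (Triangle254)
open Literature.MathematicalPhysics.QuantumFieldTheory.Balaban1983to89.T4EtaRateCoeffDefect (diagK diagK_nonneg hasMaj_mulOp)
open Literature.MathematicalPhysics.QuantumFieldTheory.Balaban1983to89.B6Prop26Gluing (mulOp mulOp_apply ind ind_nonneg ind_le_one)
open Summit.QuantumFields.YangMills.BalabanUVNodes.N15.MatrixSpecies (mmulOp mmulOp_apply hasMaj_mmulOp liftBlk liftMap liftEquiv)
open Summit.QuantumFields.YangMills.BalabanUVNodes.N15.BackgroundLayer (fgrad bgrad fgradAdj stack projO projO_none_comp_stack unstackM speciesOpM fgradMat comp_fgrad_of_intertwine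
  comp_fgradAdj_of_intertwine bgrad_eq_neg_fgradAdj mmulOp_comp_pull smul_mmulOp_sub_eq mmulOp_comp_pull_symm smul_mmulOp_translate_sub_eq unstackM_comp_stack_eq_speciesOpM_comp
  linearMap_sum_comp linearMap_comp_sum)
open Summit.QuantumFields.YangMills.BalabanUVNodes.N15.CurvedSpecies (mmulOp_comp_mulOp_fst mulOp_eq_zero_of_vanish hasMaj_smoothCut)

/-! ## §1 The matrix product rules; the species pieces behind the inserted cut, by parts onto the sandwiched right entries -/

section Algebra

variable {X ι J : Type} [Fintype ι] [Fintype J]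

omit [Fintype J] in
/-- **THE MATRIX PRODUCT RULE, forward**: `M_A∘∇⁺_e = ∇⁺_e∘M_{A∘e⁻¹} − M_{(∇⁺A)∘e⁻¹}` on the product carrier (FILE 1 `comp_fgrad_of_intertwine` at n15-c `mmulOp_comp_pull`, `smul_mmulOp_sub_eq`).
[cite: Balaban1985BackgroundPropagators, (3.52) p.400 (first-order species: shape)] -/
theorem mmulOp_comp_fgrad_eq (n : ℝ) (e : X ≃ X) (A : X → Matrix ι ι ℝ) :
    mmulOp A ∘ₗ fgrad n (liftEquiv e ι) = fgrad n (liftEquiv e ι) ∘ₗ mmulOp (A ∘ e.symm) - mmulOp (fgradMat n e A ∘ e.symm) := by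
  rw [comp_fgrad_of_intertwine n (liftEquiv e ι) (mmulOp_comp_pull A e), smul_mmulOp_sub_eq]

omit [Fintype J] in
/-- **THE MATRIX PRODUCT RULE, backward**: `M_B∘∇⁻_e = ∇⁻_e∘M_{B∘e} − M_{∇⁺B}` (`∇⁻ = −∇*`, FILE 1 `comp_fgradAdj_of_intertwine` at n15-c `mmulOp_comp_pull_symm`, `smul_mmulOp_translate_sub_eq`).
[cite: Balaban1985BackgroundPropagators, (3.52) p.400 (shape)] -/
theorem mmulOp_comp_bgrad_eq (n : ℝ) (e : X ≃ X) (B : X → Matrix ι ι ℝ) :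
    mmulOp B ∘ₗ bgrad n (liftEquiv e ι) = bgrad n (liftEquiv e ι) ∘ₗ mmulOp (B ∘ e) - mmulOp (fgradMat n e B) := by
  rw [bgrad_eq_neg_fgradAdj, LinearMap.comp_neg, comp_fgradAdj_of_intertwine n (liftEquiv e ι) (mmulOp_comp_pull_symm B e), smul_mmulOp_translate_sub_eq, LinearMap.neg_comp, neg_add]
  abel

variable {N : (X × ι → ℝ) →ₗ[ℝ] (X × ι → ℝ)} {χX : X → ℝ}

omit [Fintype J] in
/-- **THE FORWARD SPECIES PIECE BEHIND THE CUT, BY PARTS ONTO THE SANDWICHED RIGHT ENTRY**: `N∘∇⁺∘M_χ = T⁺∘M_χ` ⟹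
`N∘(M_A∇⁺)∘M_χ = T⁺∘(M_χ∘M_{A∘e⁻¹}) − N∘(M_{(∇⁺A)∘e⁻¹}∘M_χ)` (matrix coefficients commute with the cut). [cite: Balaban1984PropagatorsII, (2.133) p.247 («y′ ∈ 𝔅 ∩ T_□»: sandwiched right entries, shape)] -/
theorem comp_species_fgrad_sandwich (n : ℝ) (e : X ≃ X) (A : X → Matrix ι ι ℝ) {T : (X × ι → ℝ) →ₗ[ℝ] (X × ι → ℝ)}
    (hT : N ∘ₗ fgrad n (liftEquiv e ι) ∘ₗ mulOp (fun p : X × ι => χX p.1) = T ∘ₗ mulOp (fun p : X × ι => χX p.1)) :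
    N ∘ₗ (mmulOp A ∘ₗ fgrad n (liftEquiv e ι)) ∘ₗ mulOp (fun p : X × ι => χX p.1) =
      T ∘ₗ (mulOp (fun p : X × ι => χX p.1) ∘ₗ mmulOp (A ∘ e.symm)) - N ∘ₗ (mmulOp (fgradMat n e A ∘ e.symm) ∘ₗ mulOp (fun p : X × ι => χX p.1)) := by
  rw [mmulOp_comp_fgrad_eq, LinearMap.sub_comp, LinearMap.comp_sub]
  congr 1
  calc N ∘ₗ (fgrad n (liftEquiv e ι) ∘ₗ mmulOp (A ∘ e.symm)) ∘ₗ mulOp (fun p : X × ι => χX p.1)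
      = N ∘ₗ fgrad n (liftEquiv e ι) ∘ₗ (mmulOp (A ∘ e.symm) ∘ₗ mulOp (fun p : X × ι => χX p.1)) := by simp only [LinearMap.comp_assoc]
    _ = N ∘ₗ fgrad n (liftEquiv e ι) ∘ₗ (mulOp (fun p : X × ι => χX p.1) ∘ₗ mmulOp (A ∘ e.symm)) := by rw [mmulOp_comp_mulOp_fst]
    _ = (N ∘ₗ fgrad n (liftEquiv e ι) ∘ₗ mulOp (fun p : X × ι => χX p.1)) ∘ₗ mmulOp (A ∘ e.symm) := by simp only [LinearMap.comp_assoc]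
    _ = T ∘ₗ (mulOp (fun p : X × ι => χX p.1) ∘ₗ mmulOp (A ∘ e.symm)) := by rw [hT]; simp only [LinearMap.comp_assoc]

omit [Fintype J] in
/-- **THE BACKWARD SPECIES PIECE BEHIND THE CUT**: `N∘∇⁻∘M_χ = T⁻∘M_χ` ⟹ `N∘(M_B∇⁻)∘M_χ = T⁻∘(M_χ∘M_{B∘e}) − N∘(M_{∇⁺B}∘M_χ)`. [cite: Balaban1984PropagatorsII, (2.133) p.247 (shape)] -/
theorem comp_species_bgrad_sandwich (n : ℝ) (e : X ≃ X) (B : X → Matrix ι ι ℝ) {T : (X × ι → ℝ) →ₗ[ℝ] (X × ι → ℝ)}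
    (hT : N ∘ₗ bgrad n (liftEquiv e ι) ∘ₗ mulOp (fun p : X × ι => χX p.1) = T ∘ₗ mulOp (fun p : X × ι => χX p.1)) :
    N ∘ₗ (mmulOp B ∘ₗ bgrad n (liftEquiv e ι)) ∘ₗ mulOp (fun p : X × ι => χX p.1) =
      T ∘ₗ (mulOp (fun p : X × ι => χX p.1) ∘ₗ mmulOp (B ∘ e)) - N ∘ₗ (mmulOp (fgradMat n e B) ∘ₗ mulOp (fun p : X × ι => χX p.1)) := by
  rw [mmulOp_comp_bgrad_eq, LinearMap.sub_comp, LinearMap.comp_sub]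
  congr 1
  calc N ∘ₗ (bgrad n (liftEquiv e ι) ∘ₗ mmulOp (B ∘ e)) ∘ₗ mulOp (fun p : X × ι => χX p.1)
      = N ∘ₗ bgrad n (liftEquiv e ι) ∘ₗ (mmulOp (B ∘ e) ∘ₗ mulOp (fun p : X × ι => χX p.1)) := by simp only [LinearMap.comp_assoc]
    _ = N ∘ₗ bgrad n (liftEquiv e ι) ∘ₗ (mulOp (fun p : X × ι => χX p.1) ∘ₗ mmulOp (B ∘ e)) := by rw [mmulOp_comp_mulOp_fst]
    _ = (N ∘ₗ bgrad n (liftEquiv e ι) ∘ₗ mulOp (fun p : X × ι => χX p.1)) ∘ₗ mmulOp (B ∘ e) := by simp only [LinearMap.comp_assoc]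
    _ = T ∘ₗ (mulOp (fun p : X × ι => χX p.1) ∘ₗ mmulOp (B ∘ e)) := by rw [hT]; simp only [LinearMap.comp_assoc]

variable (τ : J → X ≃ X) (n : ℝ) {χtX : X → ℝ} {C : X → Matrix ι ι ℝ} {A : J ⊕ J → X → Matrix ι ι ℝ} {NV : (X × ι → ℝ) →ₗ[ℝ] (X × ι → ℝ)}
  {Tf Tb : J → (X × ι → ℝ) →ₗ[ℝ] (X × ι → ℝ)}

/-- **THE LETTER AS A FINITE SUM OF DISPLAYED PRODUCTS**: `(M_χ̃N)∘(unstackM C A + N_V∘pr₀)∘jet∘M_χ = M_χ̃∘[N∘(M_C∘M_χ) + Σ_μ((T⁺_μ∘(M_χM_{A⁺_μ∘e⁻¹}) − N∘(M_{(∇⁺A⁺_μ)∘e⁻¹}M_χ)) +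
(T⁻_μ∘(M_χM_{A⁻_μ∘e}) − N∘(M_{∇⁺A⁻_μ}M_χ))) + N∘(N_V∘M_χ)]`. [cite: Balaban1985BackgroundPropagators, (3.52) p.400, (3.62)–(3.65) pp.402–403 (shapes)] -/
theorem adjW_eq (hTf : ∀ μ, N ∘ₗ fgrad n (liftEquiv (τ μ) ι) ∘ₗ mulOp (fun p : X × ι => χX p.1) = Tf μ ∘ₗ mulOp (fun p : X × ι => χX p.1))
    (hTb : ∀ μ, N ∘ₗ bgrad n (liftEquiv (τ μ) ι) ∘ₗ mulOp (fun p : X × ι => χX p.1) = Tb μ ∘ₗ mulOp (fun p : X × ι => χX p.1)) :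
    (mulOp (fun p : X × ι => χtX p.1) ∘ₗ N) ∘ₗ (unstackM C A + NV ∘ₗ projO (none : Option (J ⊕ J))) ∘ₗ
        stack LinearMap.id (fun j => Sum.elim (fun μ => fgrad n (liftEquiv (τ μ) ι)) (fun μ => bgrad n (liftEquiv (τ μ) ι)) j) ∘ₗ mulOp (fun p : X × ι => χX p.1) =
      mulOp (fun p : X × ι => χtX p.1) ∘ₗ (N ∘ₗ (mmulOp C ∘ₗ mulOp (fun p : X × ι => χX p.1)) +
        ∑ μ, ((Tf μ ∘ₗ (mulOp (fun p : X × ι => χX p.1) ∘ₗ mmulOp (A (Sum.inl μ) ∘ (τ μ).symm)) -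
            N ∘ₗ (mmulOp (fgradMat n (τ μ) (A (Sum.inl μ)) ∘ (τ μ).symm) ∘ₗ mulOp (fun p : X × ι => χX p.1))) +
          (Tb μ ∘ₗ (mulOp (fun p : X × ι => χX p.1) ∘ₗ mmulOp (A (Sum.inr μ) ∘ (τ μ))) -
            N ∘ₗ (mmulOp (fgradMat n (τ μ) (A (Sum.inr μ))) ∘ₗ mulOp (fun p : X × ι => χX p.1)))) +
        N ∘ₗ (NV ∘ₗ mulOp (fun p : X × ι => χX p.1))) := by
  have hDf : ∀ μ, (fun j => Sum.elim (fun μ => fgrad n (liftEquiv (τ μ) ι)) (fun μ => bgrad n (liftEquiv (τ μ) ι)) j) (Sum.inl μ) =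
      fgrad n (liftEquiv (τ μ) ι) ∘ₗ (LinearMap.id : (X × ι → ℝ) →ₗ[ℝ] (X × ι → ℝ)) := fun μ => by rw [LinearMap.comp_id]; rfl
  have hDb : ∀ μ, (fun j => Sum.elim (fun μ => fgrad n (liftEquiv (τ μ) ι)) (fun μ => bgrad n (liftEquiv (τ μ) ι)) j) (Sum.inr μ) =
      bgrad n (liftEquiv (τ μ) ι) ∘ₗ (LinearMap.id : (X × ι → ℝ) →ₗ[ℝ] (X × ι → ℝ)) := fun μ => by rw [LinearMap.comp_id]; rfl
  have hJ : (unstackM C A + NV ∘ₗ projO (none : Option (J ⊕ J))) ∘ₗ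
      stack LinearMap.id (fun j => Sum.elim (fun μ => fgrad n (liftEquiv (τ μ) ι)) (fun μ => bgrad n (liftEquiv (τ μ) ι)) j) = speciesOpM τ n C A + NV := by
    rw [LinearMap.add_comp, unstackM_comp_stack_eq_speciesOpM_comp τ n LinearMap.id C A hDf hDb, LinearMap.comp_id, LinearMap.comp_assoc, projO_none_comp_stack, LinearMap.comp_id]
  have hS : speciesOpM τ n C A ∘ₗ mulOp (fun p : X × ι => χX p.1) = mmulOp C ∘ₗ mulOp (fun p : X × ι => χX p.1) +
      ∑ μ, ((mmulOp (A (Sum.inl μ)) ∘ₗ fgrad n (liftEquiv (τ μ) ι)) ∘ₗ mulOp (fun p : X × ι => χX p.1) +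
        (mmulOp (A (Sum.inr μ)) ∘ₗ bgrad n (liftEquiv (τ μ) ι)) ∘ₗ mulOp (fun p : X × ι => χX p.1)) := by
    simp only [speciesOpM, LinearMap.add_comp, linearMap_sum_comp]
  have hN : N ∘ₗ ((speciesOpM τ n C A + NV) ∘ₗ mulOp (fun p : X × ι => χX p.1)) = N ∘ₗ (mmulOp C ∘ₗ mulOp (fun p : X × ι => χX p.1)) +
      ∑ μ, ((Tf μ ∘ₗ (mulOp (fun p : X × ι => χX p.1) ∘ₗ mmulOp (A (Sum.inl μ) ∘ (τ μ).symm)) -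
          N ∘ₗ (mmulOp (fgradMat n (τ μ) (A (Sum.inl μ)) ∘ (τ μ).symm) ∘ₗ mulOp (fun p : X × ι => χX p.1))) +
        (Tb μ ∘ₗ (mulOp (fun p : X × ι => χX p.1) ∘ₗ mmulOp (A (Sum.inr μ) ∘ (τ μ))) -
          N ∘ₗ (mmulOp (fgradMat n (τ μ) (A (Sum.inr μ))) ∘ₗ mulOp (fun p : X × ι => χX p.1)))) +
      N ∘ₗ (NV ∘ₗ mulOp (fun p : X × ι => χX p.1)) := by
    rw [LinearMap.add_comp, LinearMap.comp_add, hS, LinearMap.comp_add, linearMap_comp_sum]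
    congr 2
    refine Finset.sum_congr rfl fun μ _ => ?_
    rw [LinearMap.comp_add, comp_species_fgrad_sandwich n (τ μ) (A (Sum.inl μ)) (hTf μ), comp_species_bgrad_sandwich n (τ μ) (A (Sum.inr μ)) (hTb μ)]
  calc (mulOp (fun p : X × ι => χtX p.1) ∘ₗ N) ∘ₗ (unstackM C A + NV ∘ₗ projO (none : Option (J ⊕ J))) ∘ₗ
        stack LinearMap.id (fun j => Sum.elim (fun μ => fgrad n (liftEquiv (τ μ) ι)) (fun μ => bgrad n (liftEquiv (τ μ) ι)) j) ∘ₗ mulOp (fun p : X × ι => χX p.1)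
      = mulOp (fun p : X × ι => χtX p.1) ∘ₗ (N ∘ₗ (((unstackM C A + NV ∘ₗ projO (none : Option (J ⊕ J))) ∘ₗ
          stack LinearMap.id (fun j => Sum.elim (fun μ => fgrad n (liftEquiv (τ μ) ι)) (fun μ => bgrad n (liftEquiv (τ μ) ι)) j)) ∘ₗ mulOp (fun p : X × ι => χX p.1))) := by
        simp only [LinearMap.comp_assoc]
    _ = _ := by rw [hJ, hN]

end Algebra

/-! ## §2 The letter's rows, two-sided localized -/

section Rows

variable {X ι J : Type} [Fintype X] [DecidableEq X] [Fintype ι] [DecidableEq ι] [Fintype J] [DecidableEq J] {g : B6.Geometry} (blk : X → g.Site) (τ : J → X ≃ X) (n : ℝ)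
  {σ cr : ℝ} {N NV : (X × ι → ℝ) →ₗ[ℝ] (X × ι → ℝ)} {χX χtX : X → ℝ} {S : Set g.Site} {C : X → Matrix ι ι ℝ} {A : J ⊕ J → X → Matrix ι ι ℝ}
  {Tf Tb : J → (X × ι → ℝ) →ₗ[ℝ] (X × ι → ℝ)}

/-- weakening of a two-sided localized letter to a plain one. [folklore] -/
theorem loc₂_le_plain {c δ : ℝ} (hc : 0 ≤ c) (y y' : g.Site) : ind S y * ind S y' * (c * Real.exp (-(δ * g.dist y y'))) ≤ c * Real.exp (-(δ * g.dist y y')) := by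
  have h1 : ind S y * ind S y' ≤ 1 := by
    calc ind S y * ind S y' ≤ 1 * 1 := mul_le_mul (ind_le_one _ _) (ind_le_one _ _) (ind_nonneg _ _) zero_le_one
      _ = 1 := one_mul _
  have h0 : 0 ≤ c * Real.exp (-(δ * g.dist y y')) := mul_nonneg hc (Real.exp_nonneg _)
  calc ind S y * ind S y' * (c * Real.exp (-(δ * g.dist y y'))) ≤ 1 * (c * Real.exp (-(δ * g.dist y y'))) := mul_le_mul_of_nonneg_right h1 h0
    _ = c * Real.exp (-(δ * g.dist y y')) := one_mul _

/-- weakening of the rate: `ce^{−δd} ≤ ce^{−ρd}` for `ρ ≤ δ`, `d ≥ 0`, `c ≥ 0`. [folklore] -/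
theorem exp_rate_mono (hd : ∀ a b : g.Site, 0 ≤ g.dist a b) {c ρ δ : ℝ} (hc : 0 ≤ c) (hρδ : ρ ≤ δ) (y y' : g.Site) :
    c * Real.exp (-(δ * g.dist y y')) ≤ c * Real.exp (-(ρ * g.dist y y')) :=
  mul_le_mul_of_nonneg_left (Real.exp_le_exp.mpr (by nlinarith [hd y y'])) hc

omit [DecidableEq X] [DecidableEq ι] in
/-- a product `T∘(M_B∘M_χ)`: `T ≤ ce^{−δd}`, `Σ_j|B_{ij}| ≤ r_B`, `|χ| ≤ 1` ⟹ `≤ c·r_B·e^{−δd}`. [folklore] -/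
theorem hasMaj_comp_mmulOp_mulOp {T : (X × ι → ℝ) →ₗ[ℝ] (X × ι → ℝ)} {B : X → Matrix ι ι ℝ} {c rB δ : ℝ} (hc : 0 ≤ c) (hrB : 0 ≤ rB) (hχ1 : ∀ x, |χX x| ≤ 1)
    (hB : ∀ x i, ∑ j, |B x i j| ≤ rB) (hT : HasMaj (BlockNorm.ofBlocks g (liftBlk blk ι)) (BlockNorm.ofBlocks g (liftBlk blk ι)) T (fun y y' => c * Real.exp (-(δ * g.dist y y')))) :
    HasMaj (BlockNorm.ofBlocks g (liftBlk blk ι)) (BlockNorm.ofBlocks g (liftBlk blk ι)) (T ∘ₗ (mmulOp B ∘ₗ mulOp (fun p : X × ι => χX p.1)))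
      (fun y y' => c * rB * Real.exp (-(δ * g.dist y y'))) := by
  have hMχ := hasMaj_mulOp (g := g) (liftBlk blk ι) (m := fun _ => (1 : ℝ)) (fun _ => zero_le_one) (fun p : X × ι => hχ1 p.1)
  have hMB := hasMaj_mmulOp blk (C := B) (fun _ => hrB) (fun x i => hB x i)
  have h1 := hasMaj_comp_diag (liftBlk blk ι) (fun a b => mul_nonneg hc (Real.exp_nonneg _)) hT hMB
  have h2 := hasMaj_comp_diag (liftBlk blk ι) (fun a b => mul_nonneg (mul_nonneg hc (Real.exp_nonneg _)) hrB) h1 hMχ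
  refine (h2.mono fun y y' => le_of_eq (by ring)).congr fun _ => rfl

omit [DecidableEq X] [DecidableEq ι] in
/-- a product `T∘(M_χ∘M_B)`: `≤ c·r_B·e^{−δd}`. [folklore] -/
theorem hasMaj_comp_mulOp_mmulOp {T : (X × ι → ℝ) →ₗ[ℝ] (X × ι → ℝ)} {B : X → Matrix ι ι ℝ} {c rB δ : ℝ} (hc : 0 ≤ c) (hrB : 0 ≤ rB) (hχ1 : ∀ x, |χX x| ≤ 1)
    (hB : ∀ x i, ∑ j, |B x i j| ≤ rB) (hT : HasMaj (BlockNorm.ofBlocks g (liftBlk blk ι)) (BlockNorm.ofBlocks g (liftBlk blk ι)) T (fun y y' => c * Real.exp (-(δ * g.dist y y')))) :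
    HasMaj (BlockNorm.ofBlocks g (liftBlk blk ι)) (BlockNorm.ofBlocks g (liftBlk blk ι)) (T ∘ₗ (mulOp (fun p : X × ι => χX p.1) ∘ₗ mmulOp B))
      (fun y y' => c * rB * Real.exp (-(δ * g.dist y y'))) := by
  have hMχ := hasMaj_mulOp (g := g) (liftBlk blk ι) (m := fun _ => (1 : ℝ)) (fun _ => zero_le_one) (fun p : X × ι => hχ1 p.1)
  have hMB := hasMaj_mmulOp blk (C := B) (fun _ => hrB) (fun x i => hB x i)
  have h1 := hasMaj_comp_diag (liftBlk blk ι) (fun a b => mul_nonneg hc (Real.exp_nonneg _)) hT hMχ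
  have h2 := hasMaj_comp_diag (liftBlk blk ι) (fun a b => mul_nonneg (mul_nonneg hc (Real.exp_nonneg _)) zero_le_one) h1 hMB
  refine (h2.mono fun y y' => le_of_eq (by ring)).congr fun _ => rfl

omit [DecidableEq X] [DecidableEq ι] [DecidableEq J] in
/-- ★★ **THE BRACKET's ROWS** (the letter without the bump in front, the flat cube read behind its cut `N_c = M_χN`, the sandwiched operators cut `T^±_c = M_χT^±`): plain letters
`N_c ≤ βe^{−δd}`, `T^±_c ≤ β^Qe^{−δd}`, the coefficient letters and the base part ⟹ `N_c(M_CM_χ) + Σ_μ[(T⁺_c(M_χM_{A⁺′}) − N_c(M_{∇A⁺′}M_χ)) + (T⁻_c(M_χM_{A⁻′}) − N_c(M_{∇A⁻}M_χ))] + N_c(N_VM_χ)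
≤ (βr_C + |J|·2(β^Qr_A + βr_∇) + βR_Nc_r)·e^{−ρd}` (exposed for the two-grid twin). [cite: Balaban1985BackgroundPropagators, (3.52) p.400, (3.62)–(3.65) pp.402–403 (shapes)] -/
theorem hasMaj_adjBracket (htri : Triangle254 g) (hd : ∀ a b : g.Site, 0 ≤ g.dist a b) (hrow : RowSum g σ cr) {ρ δ δN β βQ rC rA r₁ RN : ℝ} (hβ : 0 ≤ β)
    (hβQ : 0 ≤ βQ) (hrC : 0 ≤ rC) (hrA : 0 ≤ rA) (hr₁ : 0 ≤ r₁) (hRN : 0 ≤ RN) (hρ : 0 ≤ ρ) (hρδ : ρ ≤ δ) (hρσδ : ρ + σ ≤ δ) (hρN : ρ ≤ δN)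
    (hχ1 : ∀ x, |χX x| ≤ 1) {Nc : (X × ι → ℝ) →ₗ[ℝ] (X × ι → ℝ)} {Tfc Tbc : J → (X × ι → ℝ) →ₗ[ℝ] (X × ι → ℝ)}
    (hN0 : HasMaj (BlockNorm.ofBlocks g (liftBlk blk ι)) (BlockNorm.ofBlocks g (liftBlk blk ι)) Nc (fun y y' => β * Real.exp (-(δ * g.dist y y'))))
    (hTf' : ∀ μ, HasMaj (BlockNorm.ofBlocks g (liftBlk blk ι)) (BlockNorm.ofBlocks g (liftBlk blk ι)) (Tfc μ) (fun y y' => βQ * Real.exp (-(δ * g.dist y y'))))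
    (hTb' : ∀ μ, HasMaj (BlockNorm.ofBlocks g (liftBlk blk ι)) (BlockNorm.ofBlocks g (liftBlk blk ι)) (Tbc μ) (fun y y' => βQ * Real.exp (-(δ * g.dist y y'))))
    (hC : ∀ x i, ∑ j, |C x i j| ≤ rC) (hAf : ∀ μ x i, ∑ j, |A (Sum.inl μ) x i j| ≤ rA) (hAb : ∀ μ x i, ∑ j, |A (Sum.inr μ) x i j| ≤ rA)
    (hgAf : ∀ μ x i, ∑ j, |fgradMat n (τ μ) (A (Sum.inl μ)) x i j| ≤ r₁) (hgAb : ∀ μ x i, ∑ j, |fgradMat n (τ μ) (A (Sum.inr μ)) x i j| ≤ r₁)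
    (hNV : HasMaj (BlockNorm.ofBlocks g (liftBlk blk ι)) (BlockNorm.ofBlocks g (liftBlk blk ι)) NV (fun y y' => RN * Real.exp (-(δN * g.dist y y')))) :
    HasMaj (BlockNorm.ofBlocks g (liftBlk blk ι)) (BlockNorm.ofBlocks g (liftBlk blk ι))
      (Nc ∘ₗ (mmulOp C ∘ₗ mulOp (fun p : X × ι => χX p.1)) +
        ∑ μ, ((Tfc μ ∘ₗ (mulOp (fun p : X × ι => χX p.1) ∘ₗ mmulOp (A (Sum.inl μ) ∘ (τ μ).symm)) -
            Nc ∘ₗ (mmulOp (fgradMat n (τ μ) (A (Sum.inl μ)) ∘ (τ μ).symm) ∘ₗ mulOp (fun p : X × ι => χX p.1))) +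
          (Tbc μ ∘ₗ (mulOp (fun p : X × ι => χX p.1) ∘ₗ mmulOp (A (Sum.inr μ) ∘ (τ μ))) -
            Nc ∘ₗ (mmulOp (fgradMat n (τ μ) (A (Sum.inr μ))) ∘ₗ mulOp (fun p : X × ι => χX p.1)))) +
        Nc ∘ₗ (NV ∘ₗ mulOp (fun p : X × ι => χX p.1)))
      (fun y y' => (β * rC + Fintype.card J * (2 * (βQ * rA + β * r₁)) + β * RN * cr) * Real.exp (-(ρ * g.dist y y'))) := by
  have t1 := hasMaj_comp_mmulOp_mulOp blk hβ hrC hχ1 hC hN0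
  have tμ : ∀ μ, HasMaj (BlockNorm.ofBlocks g (liftBlk blk ι)) (BlockNorm.ofBlocks g (liftBlk blk ι))
      ((Tfc μ ∘ₗ (mulOp (fun p : X × ι => χX p.1) ∘ₗ mmulOp (A (Sum.inl μ) ∘ (τ μ).symm)) -
          Nc ∘ₗ (mmulOp (fgradMat n (τ μ) (A (Sum.inl μ)) ∘ (τ μ).symm) ∘ₗ mulOp (fun p : X × ι => χX p.1))) +
        (Tbc μ ∘ₗ (mulOp (fun p : X × ι => χX p.1) ∘ₗ mmulOp (A (Sum.inr μ) ∘ (τ μ))) -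
          Nc ∘ₗ (mmulOp (fgradMat n (τ μ) (A (Sum.inr μ))) ∘ₗ mulOp (fun p : X × ι => χX p.1))))
      (fun y y' => 2 * (βQ * rA + β * r₁) * Real.exp (-(δ * g.dist y y'))) := fun μ => by
    have a1 := hasMaj_comp_mulOp_mmulOp blk hβQ hrA hχ1 (fun x i => hAf μ ((τ μ).symm x) i) (hTf' μ)
    have a2 := hasMaj_comp_mmulOp_mulOp blk hβ hr₁ hχ1 (fun x i => hgAf μ ((τ μ).symm x) i) hN0
    have b1 := hasMaj_comp_mulOp_mmulOp blk hβQ hrA hχ1 (fun x i => hAb μ ((τ μ) x) i) (hTb' μ)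
    have b2 := hasMaj_comp_mmulOp_mulOp blk hβ hr₁ hχ1 (fun x i => hgAb μ x i) hN0
    refine ((a1.sub a2).add (b1.sub b2)).mono fun y y' => le_of_eq ?_
    ring
  have tsum := hasMaj_fsum (b₁ := BlockNorm.ofBlocks g (liftBlk blk ι)) (b₃ := BlockNorm.ofBlocks g (liftBlk blk ι)) Finset.univ _ _ fun μ _ => tμ μ
  have hNVχ : HasMaj (BlockNorm.ofBlocks g (liftBlk blk ι)) (BlockNorm.ofBlocks g (liftBlk blk ι)) (NV ∘ₗ mulOp (fun p : X × ι => χX p.1)) (fun y y' => RN * Real.exp (-(δN * g.dist y y'))) := by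
    have h := hasMaj_comp_diag (liftBlk blk ι) (fun a b => mul_nonneg hRN (Real.exp_nonneg _)) hNV
      (hasMaj_mulOp (g := g) (liftBlk blk ι) (m := fun _ => (1 : ℝ)) (fun _ => zero_le_one) (fun p : X × ι => hχ1 p.1))
    exact h.mono fun y y' => le_of_eq (mul_one _)
  have t3 := hasMaj_comp_exp (b₁ := BlockNorm.ofBlocks g (liftBlk blk ι)) (b₂ := BlockNorm.ofBlocks g (liftBlk blk ι)) (b₃ := BlockNorm.ofBlocks g (liftBlk blk ι))
    (T₁ := Nc) (T₂ := NV ∘ₗ mulOp (fun p : X × ι => χX p.1)) (ρ := ρ) htri hd hrow hβ hRN hρ hρN hρσδ hN0 hNVχ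
  refine ((t1.add tsum).add t3).mono fun y y' => ?_
  rw [Finset.sum_const, Finset.card_univ, nsmul_eq_mul, show (BlockNorm.ofBlocks g (liftBlk blk ι)).κ = 1 from rfl]
  have e1 := exp_rate_mono hd (c := β * rC) (mul_nonneg hβ hrC) hρδ y y'
  have e2 := exp_rate_mono hd (c := Fintype.card J * (2 * (βQ * rA + β * r₁))) (by positivity) hρδ y y'
  nlinarith [e1, e2, Real.exp_nonneg (-(ρ * g.dist y y'))]

omit [DecidableEq X] [DecidableEq ι] [DecidableEq J] in
/-- ★★★ **THE RESOLVENT LETTER OF THE ADJOINT FORM, TWO-SIDED LOCALIZED**: the flat cube's cut row `M_χN ≤ 1_S1_S·βe^{−δd}`, the bump `|χ̃| ≤ 1` with `M_χ̃M_χ = M_χ̃`, `M_χM_χ̃ = M_χ̃`, the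
cut's letters (`supp χ` over `S`, `|χ| ≤ 1`), the SANDWICHED right entries `N∘∇^±_μ∘M_χ = T^±_μ∘M_χ` with `T^±_μ ≤ 1_S1_S·β^Qe^{−δd}`, the coefficient letters `Σ_j|C_{ij}| ≤ r_C`,
`Σ_j|A^±_{μ,ij}| ≤ r_A`, `Σ_j|(∇⁺_μA^±_μ)_{ij}| ≤ r_∇`, the base part `N_V ≤ R_Ne^{−δ_Nd}`, and a rate `ρ ≥ 0` with `ρ ≤ δ`, `ρ + σ ≤ δ`, `ρ ≤ δ_N` ⟹
`𝒲 = (M_χ̃N)∘(unstackM C A + N_V∘pr₀)∘jet∘M_χ ≤ 1_S(y)1_S(y′)·(βr_C + |J|·(2(β^Qr_A + βr_∇)) + βR_Nc_r)·e^{−ρd}` — NO mixed row.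
[cite: Balaban1985BackgroundPropagators, (3.52) p.400, (3.62)–(3.65) pp.402–403 (shapes ∕ mechanism); Balaban1984PropagatorsII, (2.37)–(2.38) p.229, (2.133)–(2.135) p.247 (shapes)] -/
theorem hasMaj_adjW_smoothCut_loc₂ (htri : Triangle254 g) (hd : ∀ a b : g.Site, 0 ≤ g.dist a b) (hrow : RowSum g σ cr) {ρ δ δN β βQ rC rA r₁ RN : ℝ} (hβ : 0 ≤ β)
    (hβQ : 0 ≤ βQ) (hrC : 0 ≤ rC) (hrA : 0 ≤ rA) (hr₁ : 0 ≤ r₁) (hRN : 0 ≤ RN) (hcr : 0 ≤ cr) (hρ : 0 ≤ ρ) (hρδ : ρ ≤ δ) (hρσδ : ρ + σ ≤ δ) (hρN : ρ ≤ δN)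
    (hSχ : ∀ x, χX x ≠ 0 → blk x ∈ S) (hχt : ∀ x, |χtX x| ≤ 1) (hχ1 : ∀ x, |χX x| ≤ 1)
    (hsub : mulOp (fun p : X × ι => χtX p.1) ∘ₗ mulOp (fun p : X × ι => χX p.1) = mulOp (fun p : X × ι => χtX p.1))
    (hχ : mulOp (fun p : X × ι => χX p.1) ∘ₗ mulOp (fun p : X × ι => χtX p.1) = mulOp (fun p : X × ι => χtX p.1))
    (hcut : HasMaj (BlockNorm.ofBlocks g (liftBlk blk ι)) (BlockNorm.ofBlocks g (liftBlk blk ι)) (mulOp (fun p : X × ι => χX p.1) ∘ₗ N) (fun y y' => ind S y * ind S y' * (β * Real.exp (-(δ * g.dist y y')))))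
    (hTf : ∀ μ, N ∘ₗ fgrad n (liftEquiv (τ μ) ι) ∘ₗ mulOp (fun p : X × ι => χX p.1) = Tf μ ∘ₗ mulOp (fun p : X × ι => χX p.1))
    (hTb : ∀ μ, N ∘ₗ bgrad n (liftEquiv (τ μ) ι) ∘ₗ mulOp (fun p : X × ι => χX p.1) = Tb μ ∘ₗ mulOp (fun p : X × ι => χX p.1))
    (hTfr : ∀ μ, HasMaj (BlockNorm.ofBlocks g (liftBlk blk ι)) (BlockNorm.ofBlocks g (liftBlk blk ι)) (Tf μ) (fun y y' => ind S y * ind S y' * (βQ * Real.exp (-(δ * g.dist y y')))))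
    (hTbr : ∀ μ, HasMaj (BlockNorm.ofBlocks g (liftBlk blk ι)) (BlockNorm.ofBlocks g (liftBlk blk ι)) (Tb μ) (fun y y' => ind S y * ind S y' * (βQ * Real.exp (-(δ * g.dist y y')))))
    (hC : ∀ x i, ∑ j, |C x i j| ≤ rC) (hAf : ∀ μ x i, ∑ j, |A (Sum.inl μ) x i j| ≤ rA) (hAb : ∀ μ x i, ∑ j, |A (Sum.inr μ) x i j| ≤ rA)
    (hgAf : ∀ μ x i, ∑ j, |fgradMat n (τ μ) (A (Sum.inl μ)) x i j| ≤ r₁) (hgAb : ∀ μ x i, ∑ j, |fgradMat n (τ μ) (A (Sum.inr μ)) x i j| ≤ r₁)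
    (hNV : HasMaj (BlockNorm.ofBlocks g (liftBlk blk ι)) (BlockNorm.ofBlocks g (liftBlk blk ι)) NV (fun y y' => RN * Real.exp (-(δN * g.dist y y')))) :
    HasMaj (BlockNorm.ofBlocks g (liftBlk blk ι)) (BlockNorm.ofBlocks g (liftBlk blk ι))
      ((mulOp (fun p : X × ι => χtX p.1) ∘ₗ N) ∘ₗ (unstackM C A + NV ∘ₗ projO (none : Option (J ⊕ J))) ∘ₗ
        stack LinearMap.id (fun j => Sum.elim (fun μ => fgrad n (liftEquiv (τ μ) ι)) (fun μ => bgrad n (liftEquiv (τ μ) ι)) j) ∘ₗ mulOp (fun p : X × ι => χX p.1))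
      (fun y y' => ind S y * ind S y' * ((β * rC + Fintype.card J * (2 * (βQ * rA + β * r₁)) + β * RN * cr) * Real.exp (-(ρ * g.dist y y')))) := by
  -- the flat cube behind its cut, and the sandwiched operators, as PLAIN letters
  have hN0 : HasMaj (BlockNorm.ofBlocks g (liftBlk blk ι)) (BlockNorm.ofBlocks g (liftBlk blk ι)) (mulOp (fun p : X × ι => χX p.1) ∘ₗ N) (fun y y' => β * Real.exp (-(δ * g.dist y y'))) :=
    hcut.mono fun y y' => loc₂_le_plain hβ y y'
  have hTf' : ∀ μ, HasMaj (BlockNorm.ofBlocks g (liftBlk blk ι)) (BlockNorm.ofBlocks g (liftBlk blk ι)) (mulOp (fun p : X × ι => χX p.1) ∘ₗ Tf μ)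
      (fun y y' => βQ * Real.exp (-(δ * g.dist y y'))) := fun μ => by
    have h := hasMaj_diag_comp (liftBlk blk ι) (fun _ => zero_le_one)
      (hasMaj_mulOp (g := g) (liftBlk blk ι) (m := fun _ => (1 : ℝ)) (fun _ => zero_le_one) (fun p : X × ι => hχ1 p.1)) ((hTfr μ).mono fun y y' => loc₂_le_plain hβQ y y')
    exact h.mono fun y y' => le_of_eq (one_mul _)
  have hTb' : ∀ μ, HasMaj (BlockNorm.ofBlocks g (liftBlk blk ι)) (BlockNorm.ofBlocks g (liftBlk blk ι)) (mulOp (fun p : X × ι => χX p.1) ∘ₗ Tb μ)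
      (fun y y' => βQ * Real.exp (-(δ * g.dist y y'))) := fun μ => by
    have h := hasMaj_diag_comp (liftBlk blk ι) (fun _ => zero_le_one)
      (hasMaj_mulOp (g := g) (liftBlk blk ι) (m := fun _ => (1 : ℝ)) (fun _ => zero_le_one) (fun p : X × ι => hχ1 p.1)) ((hTbr μ).mono fun y y' => loc₂_le_plain hβQ y y')
    exact h.mono fun y y' => le_of_eq (one_mul _)
  -- the sandwiches for the CUT cube `M_χN`
  have hTfc : ∀ μ, (mulOp (fun p : X × ι => χX p.1) ∘ₗ N) ∘ₗ fgrad n (liftEquiv (τ μ) ι) ∘ₗ mulOp (fun p : X × ι => χX p.1) =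
      (mulOp (fun p : X × ι => χX p.1) ∘ₗ Tf μ) ∘ₗ mulOp (fun p : X × ι => χX p.1) := fun μ => by
    rw [LinearMap.comp_assoc, hTf μ, ← LinearMap.comp_assoc]
  have hTbc : ∀ μ, (mulOp (fun p : X × ι => χX p.1) ∘ₗ N) ∘ₗ bgrad n (liftEquiv (τ μ) ι) ∘ₗ mulOp (fun p : X × ι => χX p.1) =
      (mulOp (fun p : X × ι => χX p.1) ∘ₗ Tb μ) ∘ₗ mulOp (fun p : X × ι => χX p.1) := fun μ => by
    rw [LinearMap.comp_assoc, hTb μ, ← LinearMap.comp_assoc]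
  -- the plain bound, with `N` read behind its cut
  have key : HasMaj (BlockNorm.ofBlocks g (liftBlk blk ι)) (BlockNorm.ofBlocks g (liftBlk blk ι))
      ((mulOp (fun p : X × ι => χtX p.1) ∘ₗ N) ∘ₗ (unstackM C A + NV ∘ₗ projO (none : Option (J ⊕ J))) ∘ₗ
        stack LinearMap.id (fun j => Sum.elim (fun μ => fgrad n (liftEquiv (τ μ) ι)) (fun μ => bgrad n (liftEquiv (τ μ) ι)) j) ∘ₗ mulOp (fun p : X × ι => χX p.1))
      (fun y y' => (β * rC + Fintype.card J * (2 * (βQ * rA + β * r₁)) + β * RN * cr) * Real.exp (-(ρ * g.dist y y'))) := by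
    have hins : mulOp (fun p : X × ι => χtX p.1) ∘ₗ N = mulOp (fun p : X × ι => χtX p.1) ∘ₗ (mulOp (fun p : X × ι => χX p.1) ∘ₗ N) := by
      rw [← LinearMap.comp_assoc, hsub]
    rw [hins, adjW_eq τ n hTfc hTbc]
    have hbr := hasMaj_adjBracket blk τ n htri hd hrow hβ hβQ hrC hrA hr₁ hRN hρ hρδ hρσδ hρN hχ1 hN0 hTf' hTb' hC hAf hAb hgAf hgAb hNV
    have hfin := hasMaj_diag_comp (liftBlk blk ι) (fun _ => zero_le_one)
      (hasMaj_mulOp (g := g) (liftBlk blk ι) (m := fun _ => (1 : ℝ)) (fun _ => zero_le_one) (fun p : X × ι => hχt p.1)) hbr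
    exact hfin.mono fun y y' => le_of_eq (one_mul _)
  -- two-sided localization from the cuts
  have hout : mulOp (fun p : X × ι => χX p.1) ∘ₗ ((mulOp (fun p : X × ι => χtX p.1) ∘ₗ N) ∘ₗ (unstackM C A + NV ∘ₗ projO (none : Option (J ⊕ J))) ∘ₗ
      stack LinearMap.id (fun j => Sum.elim (fun μ => fgrad n (liftEquiv (τ μ) ι)) (fun μ => bgrad n (liftEquiv (τ μ) ι)) j) ∘ₗ mulOp (fun p : X × ι => χX p.1)) =
      (mulOp (fun p : X × ι => χtX p.1) ∘ₗ N) ∘ₗ (unstackM C A + NV ∘ₗ projO (none : Option (J ⊕ J))) ∘ₗ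
        stack LinearMap.id (fun j => Sum.elim (fun μ => fgrad n (liftEquiv (τ μ) ι)) (fun μ => bgrad n (liftEquiv (τ μ) ι)) j) ∘ₗ mulOp (fun p : X × ι => χX p.1) := by
    simp only [← LinearMap.comp_assoc]
    rw [hχ]
  refine hasMaj_localize (liftBlk blk ι) (liftBlk blk ι) (fun a b => mul_nonneg (by positivity) (Real.exp_nonneg _)) (fun μ p hp => ?_) (fun μ hμ => ?_) key
  · have hχ0 : χX p.1 = 0 := by by_contra h; exact hp (hSχ p.1 h)
    rw [← hout]
    simp only [LinearMap.comp_apply, mulOp_apply, hχ0, zero_mul]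
  · simp only [LinearMap.comp_apply, mulOp_eq_zero_of_vanish blk hSχ μ hμ, map_zero]

omit [DecidableEq X] [DecidableEq ι] [DecidableEq J] in
/-- ★ **… PLAIN** (FILE 148's `hW`): the indicators dropped. [cite: Balaban1985BackgroundPropagators, (3.62)–(3.65) pp.402–403 (mechanism)] -/
theorem hasMaj_adjW_smoothCut (htri : Triangle254 g) (hd : ∀ a b : g.Site, 0 ≤ g.dist a b) (hrow : RowSum g σ cr) {ρ δ δN β βQ rC rA r₁ RN : ℝ} (hβ : 0 ≤ β)
    (hβQ : 0 ≤ βQ) (hrC : 0 ≤ rC) (hrA : 0 ≤ rA) (hr₁ : 0 ≤ r₁) (hRN : 0 ≤ RN) (hcr : 0 ≤ cr) (hρ : 0 ≤ ρ) (hρδ : ρ ≤ δ) (hρσδ : ρ + σ ≤ δ) (hρN : ρ ≤ δN)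
    (hSχ : ∀ x, χX x ≠ 0 → blk x ∈ S) (hχt : ∀ x, |χtX x| ≤ 1) (hχ1 : ∀ x, |χX x| ≤ 1)
    (hsub : mulOp (fun p : X × ι => χtX p.1) ∘ₗ mulOp (fun p : X × ι => χX p.1) = mulOp (fun p : X × ι => χtX p.1))
    (hχ : mulOp (fun p : X × ι => χX p.1) ∘ₗ mulOp (fun p : X × ι => χtX p.1) = mulOp (fun p : X × ι => χtX p.1))
    (hcut : HasMaj (BlockNorm.ofBlocks g (liftBlk blk ι)) (BlockNorm.ofBlocks g (liftBlk blk ι)) (mulOp (fun p : X × ι => χX p.1) ∘ₗ N) (fun y y' => ind S y * ind S y' * (β * Real.exp (-(δ * g.dist y y')))))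
    (hTf : ∀ μ, N ∘ₗ fgrad n (liftEquiv (τ μ) ι) ∘ₗ mulOp (fun p : X × ι => χX p.1) = Tf μ ∘ₗ mulOp (fun p : X × ι => χX p.1))
    (hTb : ∀ μ, N ∘ₗ bgrad n (liftEquiv (τ μ) ι) ∘ₗ mulOp (fun p : X × ι => χX p.1) = Tb μ ∘ₗ mulOp (fun p : X × ι => χX p.1))
    (hTfr : ∀ μ, HasMaj (BlockNorm.ofBlocks g (liftBlk blk ι)) (BlockNorm.ofBlocks g (liftBlk blk ι)) (Tf μ) (fun y y' => ind S y * ind S y' * (βQ * Real.exp (-(δ * g.dist y y')))))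
    (hTbr : ∀ μ, HasMaj (BlockNorm.ofBlocks g (liftBlk blk ι)) (BlockNorm.ofBlocks g (liftBlk blk ι)) (Tb μ) (fun y y' => ind S y * ind S y' * (βQ * Real.exp (-(δ * g.dist y y')))))
    (hC : ∀ x i, ∑ j, |C x i j| ≤ rC) (hAf : ∀ μ x i, ∑ j, |A (Sum.inl μ) x i j| ≤ rA) (hAb : ∀ μ x i, ∑ j, |A (Sum.inr μ) x i j| ≤ rA)
    (hgAf : ∀ μ x i, ∑ j, |fgradMat n (τ μ) (A (Sum.inl μ)) x i j| ≤ r₁) (hgAb : ∀ μ x i, ∑ j, |fgradMat n (τ μ) (A (Sum.inr μ)) x i j| ≤ r₁)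
    (hNV : HasMaj (BlockNorm.ofBlocks g (liftBlk blk ι)) (BlockNorm.ofBlocks g (liftBlk blk ι)) NV (fun y y' => RN * Real.exp (-(δN * g.dist y y')))) :
    HasMaj (BlockNorm.ofBlocks g (liftBlk blk ι)) (BlockNorm.ofBlocks g (liftBlk blk ι))
      ((mulOp (fun p : X × ι => χtX p.1) ∘ₗ N) ∘ₗ (unstackM C A + NV ∘ₗ projO (none : Option (J ⊕ J))) ∘ₗ
        stack LinearMap.id (fun j => Sum.elim (fun μ => fgrad n (liftEquiv (τ μ) ι)) (fun μ => bgrad n (liftEquiv (τ μ) ι)) j) ∘ₗ mulOp (fun p : X × ι => χX p.1))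
      (fun y y' => (β * rC + Fintype.card J * (2 * (βQ * rA + β * r₁)) + β * RN * cr) * Real.exp (-(ρ * g.dist y y'))) :=
  (hasMaj_adjW_smoothCut_loc₂ blk τ n htri hd hrow hβ hβQ hrC hrA hr₁ hRN hcr hρ hρδ hρσδ hρN hSχ hχt hχ1 hsub hχ hcut hTf hTb hTfr hTbr hC hAf hAb hgAf hgAb hNV).mono
    fun y y' => loc₂_le_plain (by positivity) y y'

end Rows

end Summit.QuantumFields.YangMills.BalabanUVNodes.N15.Gluing

end
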